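import Summits.QuantumFields.YangMills.Theorems.BalabanUVNodesN08HaarCompatibilityGuardJacobianContractionFrame

/-!
# BalabanUVNodes ∕ N08 — THE TANGENT MAP OF THE PRINTED exp-mean-log FIBRE MAP IS AN hs-CONTRACTION ON THE GUARD (part 3b):
# `hs(D K_W(W X), D K_W(W X)) ≤ (1 − Σᵢ cᵢ(1 − ψρᵢ))²·hs(X, X) ≤ hs(X, X)` — the upper half of the Jacobian pinch

WIDTH SEAT `pub-ymgap-dag-n08-w6` g4 (R399 (3a) second wave; CLAIM-2 ∕ INTENT-3 of record HOME INBOX l.32241), 2026-08-28.  Track A, DAG node N08 =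
[Balaban1985UV3] Thm 1 p. 257 (compact) + Thm 2 p. 272; key item K1⁷ `StabilityBAtRecordR13SepCoPH` (stmt-QuantumFields-20542), `--supports … --as helper`.
COUNT-NEUTRAL.

THE MATHEMATICS ([folklore]).  `Zᵢ = log(hᵢW*)` (skew, `‖Zᵢ‖ ≤ ρᵢ ≤ 1`), `Y = ΣcᵢZᵢ`, `X̃ = WXW*`.  The solution operator of `dexp(Z)H = exp(Z)X` is
`S_Z = φ(B_Z) + ½ad_Z` — in `Z`'s eigenframe the multiplier `e^{−iθₐ}∕dd_{ab} = φ(β_{ab}) − iβ_{ab}` (part 3a's `exp_div_dd_eq`), `φ = 1 − ψ`,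
`½ad_Z` the multiplier `−iβ_{ab}` — §1 proves existence, uniqueness and this split.  pub-balaban's bookkeeping gives
`D K_W(WX)·W* = exp(Y)X̃ − dexp(Y)(ΣcᵢS_{Zᵢ}X̃) = dexp(Y)·[S_Y − ΣcᵢS_{Zᵢ}]X̃`, and SINCE `Y = ΣcᵢZᵢ` THE `½ad` HALVES CANCEL (`adh_sum_smul`):
`[S_Y − ΣcᵢS_{Zᵢ}]X̃ = Q X̃`, `Q := φ(B_Y) − Σcᵢφ(B_{Zᵢ})` — a difference of REAL frame multipliers (different frames), hence hs-SYMMETRIC; `Q ⪰ (1 − Σcᵢ)·1 ⪰ 0`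
is pub-balaban's KEY + Jensen (g3's `jensen_hs_le`); `Q ⪯ (1 − Σcᵢ(1 − ψρᵢ))·1 =: κ·1` because `φ ≤ 1` (`ψ ≥ 0`) and `φ(B_{Zᵢ}) ⪰ φ(ρᵢ)·1` (`ψ` monotone,
`|β^{(i)}_{ab}| ≤ ‖Zᵢ‖ ≤ ρᵢ`).  Cauchy–Schwarz for the psd form `hs(·,Q·)` (part 3a) yields `‖QX̃‖ ≤ κ‖X̃‖` (§2 ★★ `hs_symmetrised_self_le`), and
`|dexp Y| ≤ 1` (`|dd| = sinc ≤ 1`, §3 `hs_dexp_self_le`) finishes: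
  ★★★ `emlD_tangent_upper_bound`: `hs(D K_W(WX), D K_W(WX)) ≤ (1 − Σᵢcᵢ(1 − ψρᵢ))²·hs(X, X)`  (`‖log(hᵢW*)‖ ≤ ρᵢ ≤ 1`);
  ★★ `emlD_tangent_upper_bound_log_two`: the `W`-uniform constant `1 − (log 2·cot log 2)·Σcᵢ` (`= 1 − 0.835…·Σcᵢ`) on the guard;
  ★★ `emlD_tangent_contraction` (+ `…_specialUnitary` at the typed guard `deltaSU`): `hs(D K_W(WX), D K_W(WX)) ≤ hs(X, X)`.
With g3's lower half (p612264) every Hilbert–Schmidt singular value of the tangent map on `𝔲(N)` lies in `[1 − Σcᵢ, 1 − Σcᵢρᵢcotρᵢ] ⊆ [1 − Σcᵢ, 1]`; both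
ends coincide (`= 1 − Σcᵢ`) at the flat background.  NUMERICS (this seat, pure python, session `work/numerics/pinch.py`; evidence only, used by no proof): 120
random guarded U(2)∕U(3) families — `σ_max ∕ (1 − Σcᵢρᵢcotρᵢ) ≤ 0.99994` with `ρᵢ = ‖log(hᵢW*)‖`, never above; `σ_min∕(1 − Σcᵢ) = 1.000000` (central direction).

HONEST FRAMING.  Count-neutral helper ([folklore] matrix analysis about the printed (0.4)∕(1.4) fibre map over pub-balaban's `T4EMLTangentInjective` and g3's frame files BY
IMPORT); NO quantitative `T4Haar*LocalDiffeo`, NO density bound, NO sheet count, NO injectivity window typed; nothing of Bałaban's asserted; E6′ NOT decided;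
`hmass` NOT supplied; N08 NOT discharged; counts unmoved (typed 28∕28 · discharged 5∕27); no summit statement is proved by this seat — one finite 𝕋⁴ programme at
fixed ε, R4 closes the CONDITIONAL rung `BalabanLadder.UV` only; the Yang–Mills mass gap (Clay) is NOT proved by any of this; nothing continuum ∕ ℝ⁴ ∕ OS.
0 `sorry`, 0 `def`, 0 `instance`, 0 `notation`, standard axioms.
-/

noncomputable section

open NormedSpace Finset
open scoped Matrix Matrix.Norms.L2Operator ComplexConjugate Nat

namespace Summit.QuantumFields.YangMills.BalabanUVNodes.N08HaarCompatibilityGuardJacobianContractionOperator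

open Literature.MathematicalPhysics.QuantumFieldTheory.Balaban1983to89
open Literature.MathematicalPhysics.QuantumFieldTheory.Balaban1983to89.T4EMLTangentInjective
open Summit.QuantumFields.YangMills.BalabanUVNodes.N08HaarCompatibilityGuardJacobian
open Summit.QuantumFields.YangMills.BalabanUVNodes.N08HaarCompatibilityGuardJacobianSharpFrame
open Summit.QuantumFields.YangMills.BalabanUVNodes.N08HaarCompatibilityGuardJacobianSharp
open Summit.QuantumFields.YangMills.BalabanUVNodes.N08HaarCompatibilityGuardJacobianContractionFrame
open Matrix (single diagonal unitaryGroup)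
open Complex (I)
open Literature.MathematicalPhysics.QuantumFieldTheory.Balaban1983to89.MatrixLog (mlog)
open T4QuatExpLog (ψ ψ_zero ψ_of_ne_zero)

variable {m : Type*} [Fintype m] [DecidableEq m] [Nonempty m] {ι : Type*} [Fintype ι]

/-! ## §1 The solution operator of `dexp(Z) H = exp(Z)·X` is `φ(B_Z) + ½ad_Z` (frame form, existence, uniqueness) -/

section Solution

variable {U : Matrix m m ℂ}

omit [Nonempty m] [Fintype ι] in
/-- **A frame with controlled angles.**  Skew-Hermitian `Z` with `‖Z‖ ≤ ρ ≤ 1` has an eigenframe `Z = U diag(−iθ) U*` with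
`|θₐ| ≤ ρ`, hence all half-angles `|β_{ab}| ≤ ρ < π`. [folklore] -/
theorem exists_frame_le {Z : Matrix m m ℂ} (hZ : Zᴴ = -Z) {ρ : ℝ} (hZρ : ‖Z‖ ≤ ρ) (hρ1 : ρ ≤ 1) :
    ∃ (U : Matrix m m ℂ) (θ : m → ℝ), star U * U = 1 ∧ U * star U = 1 ∧
      Z = U * diagonal (fun a => -I * (θ a : ℂ)) * star U ∧ (∀ a b, |(θ a - θ b) / 2| ≤ ρ) ∧
        ∀ a b, |(θ a - θ b) / 2| < Real.pi := by
  obtain ⟨U, θ, hU, hU', hZU, hθ⟩ := frame hZ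
  have hβ : ∀ a b, |(θ a - θ b) / 2| ≤ ρ := fun a b => by
    rw [abs_div, abs_two]
    have := abs_sub (θ a) (θ b)
    linarith [(hθ a).trans hZρ, (hθ b).trans hZρ]
  exact ⟨U, θ, hU, hU', hZU, hβ, fun a b => (hβ a b).trans_lt (by linarith [Real.pi_gt_three])⟩

/-- **EXISTENCE in frame form**: `H♮ := U·((e^{−iθₐ}∕dd_{ab})·X'_{ab})·U*` solves `dexp(Z) H♮ = exp(Z)·X`. [folklore] -/
theorem dexp_frameSol (hU : star U * U = 1) (hU' : U * star U = 1) (θ : m → ℝ) (hβ : ∀ a b, |(θ a - θ b) / 2| < Real.pi)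
    {Z : Matrix m m ℂ} (hZU : Z = U * diagonal (fun a => -I * (θ a : ℂ)) * star U) (X : Matrix m m ℂ) :
    dexp Z (U * Matrix.of (fun a b => (Complex.exp (-I * θ a) / dd (-I * θ a) (-I * θ b)) * (star U * X * U) a b) * star U)
      = exp Z * X := by
  have hl : ∀ a b, Z * Fu U a b = (-I * (θ a : ℂ)) • Fu U a b := fun a b => by
    rw [hZU]; exact frame_mul_Fu hU _ a b
  have hr : ∀ a b, Fu U a b * Z = (-I * (θ b : ℂ)) • Fu U a b := fun a b => by
    rw [hZU]; exact Fu_mul_frame hU _ a b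
  have hdexp : ∀ a b, dexp Z (Fu U a b) = dd (-I * θ a) (-I * θ b) • Fu U a b := fun a b =>
    dexp_eigen (hl a b) (hr a b)
  have h1 := linmap_frame (dexp Z).toLinearMap _ hdexp
    (Matrix.of (fun a b => (Complex.exp (-I * θ a) / dd (-I * θ a) (-I * θ b)) * (star U * X * U) a b))
  rw [ContinuousLinearMap.coe_coe] at h1
  rw [h1, exp_mul_frame hU hU' θ hZU X]
  congr 2
  ext a b
  rw [Matrix.of_apply, Matrix.of_apply, Matrix.of_apply, ← mul_assoc, mul_div_cancel₀ _ (dd_ratio (hβ a b)).1]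

omit [Nonempty m] in
/-- **The frame solution IS `φ(B_Z)X + ½ad_Z X`**: `U·((e^{−iθₐ}∕dd)·X')·U* = U·((1 − ψβ)·X')·U* + adh Z X` (`exp_div_dd_eq`,
`adh_frame`). [folklore] -/
theorem frameSol_eq_phi_add_adh (hU : star U * U = 1) (hU' : U * star U = 1) (θ : m → ℝ)
    (hβ : ∀ a b, |(θ a - θ b) / 2| < Real.pi) {Z : Matrix m m ℂ}
    (hZU : Z = U * diagonal (fun a => -I * (θ a : ℂ)) * star U) (X : Matrix m m ℂ) :
    U * Matrix.of (fun a b => (Complex.exp (-I * θ a) / dd (-I * θ a) (-I * θ b)) * (star U * X * U) a b) * star U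
      = U * Matrix.of (fun a b => ((1 - ψ ((θ a - θ b) / 2) : ℝ) : ℂ) * (star U * X * U) a b) * star U + adh Z X := by
  rw [adh_frame hU hU' θ hZU X, ← Matrix.add_mul, ← Matrix.mul_add]
  congr 2
  ext a b
  simp only [Matrix.of_apply, Matrix.add_apply]
  rw [exp_div_dd_eq (hβ a b)]
  ring

/-- **UNIQUENESS**: every solution of `dexp(Z) H = exp(Z)·X` is the frame solution (`coef_of_dexp_eq_frame`, `dd ≠ 0`). [folklore] -/
theorem eq_frameSol_of_dexp_eq (hU : star U * U = 1) (hU' : U * star U = 1) (θ : m → ℝ)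
    (hβ : ∀ a b, |(θ a - θ b) / 2| < Real.pi) {Z : Matrix m m ℂ}
    (hZU : Z = U * diagonal (fun a => -I * (θ a : ℂ)) * star U) (X H : Matrix m m ℂ) (hH : dexp Z H = exp Z * X) :
    H = U * Matrix.of (fun a b => (Complex.exp (-I * θ a) / dd (-I * θ a) (-I * θ b)) * (star U * X * U) a b) * star U := by
  have hcoef := coef_of_dexp_eq_frame hU hU' θ hZU X H (fun a _ => Complex.exp (-I * θ a))
    (hH.trans (exp_mul_frame hU hU' θ hZU X))
  conv_lhs => rw [(conj_unconj hU' H).symm]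
  congr 2
  ext a b
  rw [Matrix.of_apply, div_mul_eq_mul_div, eq_div_iff (dd_ratio (hβ a b)).1, mul_comm]
  exact hcoef a b

/-- **Every solution is `φ(B_Z)X + ½ad_Z X`.** [folklore] -/
theorem solution_eq_phi_add_adh (hU : star U * U = 1) (hU' : U * star U = 1) (θ : m → ℝ)
    (hβ : ∀ a b, |(θ a - θ b) / 2| < Real.pi) {Z : Matrix m m ℂ}
    (hZU : Z = U * diagonal (fun a => -I * (θ a : ℂ)) * star U) (X H : Matrix m m ℂ) (hH : dexp Z H = exp Z * X) :
    H = U * Matrix.of (fun a b => ((1 - ψ ((θ a - θ b) / 2) : ℝ) : ℂ) * (star U * X * U) a b) * star U + adh Z X := by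
  rw [eq_frameSol_of_dexp_eq hU hU' θ hβ hZU X H hH, frameSol_eq_phi_add_adh hU hU' θ hβ hZU X]

/-- **`φ(B_Z)X + ½ad_Z X` solves the system** (existence in the symmetric∕antisymmetric split). [folklore] -/
theorem dexp_phi_add_adh (hU : star U * U = 1) (hU' : U * star U = 1) (θ : m → ℝ)
    (hβ : ∀ a b, |(θ a - θ b) / 2| < Real.pi) {Z : Matrix m m ℂ}
    (hZU : Z = U * diagonal (fun a => -I * (θ a : ℂ)) * star U) (X : Matrix m m ℂ) :
    dexp Z (U * Matrix.of (fun a b => ((1 - ψ ((θ a - θ b) / 2) : ℝ) : ℂ) * (star U * X * U) a b) * star U + adh Z X)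
      = exp Z * X := by
  rw [← frameSol_eq_phi_add_adh hU hU' θ hβ hZU X, dexp_frameSol hU hU' θ hβ hZU X]

omit [Nonempty m] [Fintype ι] in
/-- `hs(X, ½ad_W X) = 0` for skew-Hermitian `W` (`½ad_W` is hs-antisymmetric). [folklore] -/
theorem hs_adh_self {W : Matrix m m ℂ} (hW : Wᴴ = -W) (X : Matrix m m ℂ) : hs X (adh W X) = 0 := by
  have h := hs_adh_right hW X X
  have h2 : hs (adh W X) X = hs X (adh W X) := hs_comm X (adh W X)
  linarith

end Solution

/-! ## §2 THE SYMMETRISED TANGENT OPERATOR `Q = φ(B_Y) − Σcᵢφ(B_{Zᵢ})`: `‖Q X‖²_HS ≤ (1 − Σcᵢ(1 − ψρᵢ))²·‖X‖²_HS` -/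

section Operator

/-- ★★ **THE UPPER BOUND FOR THE SYMMETRISED TANGENT IMAGE.**  `Zᵢ` skew-Hermitian with `‖Zᵢ‖ ≤ ρᵢ ≤ 1`, weights `cᵢ ≥ 0`,
`Σcᵢ ≤ 1`, `Y = ΣcᵢZᵢ`; for ANY solutions `dexp(Zᵢ)Hᵢ = exp(Zᵢ)X`, `dexp(Y)H_Y = exp(Y)X`:
  `hs(H_Y − ΣcᵢHᵢ, H_Y − ΣcᵢHᵢ) ≤ (1 − Σcᵢ·(1 − ψρᵢ))²·hs(X, X)`     (`1 − ψρ = ρ cot ρ`).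
PROOF.  `Hᵢ = φ(B_{Zᵢ})X + ½ad_{Zᵢ}X`, `H_Y = φ(B_Y)X + ½ad_Y X` (§1) and `ad_Y = Σcᵢ ad_{Zᵢ}`, so `H_Y − ΣcᵢHᵢ = Q X` with
`Q = φ(B_Y) − Σcᵢφ(B_{Zᵢ})` a difference of REAL frame multipliers: hs-symmetric (`hs_frameMul_symm`), `Q ⪰ (1 − Σcᵢ)·1 ⪰ 0`
(g3's `jensen_hs_le` = pub-balaban's KEY + Jensen, the `½ad` forms vanishing on the diagonal), `Q ⪯ (1 − Σcᵢ(1 − ψρᵢ))·1`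
(`φ ≤ 1` since `ψ ≥ 0`; `φ(B_{Zᵢ}) ⪰ (1 − ψρᵢ)·1` since `ψ` is increasing and `|β^{(i)}_{ab}| ≤ ρᵢ`); then Cauchy–Schwarz for the
psd form (`hs_apply_self_le_of_symm_psd`). [folklore] -/
theorem hs_symmetrised_self_le {Z : ι → Matrix m m ℂ} (hZ : ∀ i, (Z i)ᴴ = -Z i) (ρ : ι → ℝ) (hZρ : ∀ i, ‖Z i‖ ≤ ρ i)
    (hρ1 : ∀ i, ρ i ≤ 1) (c : ι → ℝ) (hc0 : ∀ i, 0 ≤ c i) (hc1 : ∑ i, c i ≤ 1) (X : Matrix m m ℂ)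
    (H : ι → Matrix m m ℂ) (HY : Matrix m m ℂ) (hH : ∀ i, dexp (Z i) (H i) = exp (Z i) * X)
    (hY : dexp (∑ i, (c i : ℂ) • Z i) HY = exp (∑ i, (c i : ℂ) • Z i) * X) :
    hs (HY - ∑ i, (c i : ℂ) • H i) (HY - ∑ i, (c i : ℂ) • H i) ≤ (1 - ∑ i, c i * (1 - ψ (ρ i))) ^ 2 * hs X X := by
  have hZ1 : ∀ i, ‖Z i‖ ≤ 1 := fun i => (hZρ i).trans (hρ1 i)
  set Y : Matrix m m ℂ := ∑ i, (c i : ℂ) • Z i with hYdef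
  have hYskew : Yᴴ = -Y := conjTranspose_sum_smul c hZ
  have hY1 : ‖Y‖ ≤ 1 := by
    calc ‖Y‖ ≤ ∑ i, ‖(c i : ℂ) • Z i‖ := norm_sum_le _ _
      _ ≤ ∑ i, c i := Finset.sum_le_sum fun i _ => by
          rw [norm_smul, Complex.norm_real, Real.norm_of_nonneg (hc0 i)]
          nlinarith [hZ1 i, hc0 i, norm_nonneg (Z i)]
      _ ≤ 1 := hc1
  -- frames: `Y = U₀ diag(−iθ₀) U₀*`, `Zᵢ = Uᵢ diag(−iθᵢ) Uᵢ*`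
  obtain ⟨U₀, θ₀, hU₀, hU₀', hYU, -, hβ₀⟩ := exists_frame_le hYskew hY1 le_rfl
  have hfr := fun i => exists_frame_le (hZ i) (hZρ i) (hρ1 i)
  choose V θ hV hV' hZV hβρ hβπ using hfr
  -- the real frame multipliers `φ(B_Y)`, `φ(B_{Zᵢ})` and `Q`
  set Φ₀ : Matrix m m ℂ → Matrix m m ℂ := fun x =>
    U₀ * Matrix.of (fun a b => ((1 - ψ ((θ₀ a - θ₀ b) / 2) : ℝ) : ℂ) * (star U₀ * x * U₀) a b) * star U₀ with hΦ₀
  set Φ : ι → Matrix m m ℂ → Matrix m m ℂ := fun i x =>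
    V i * Matrix.of (fun a b => ((1 - ψ ((θ i a - θ i b) / 2) : ℝ) : ℂ) * (star (V i) * x * V i) a b) * star (V i) with hΦ
  set Q : Matrix m m ℂ → Matrix m m ℂ := fun x => Φ₀ x - ∑ i, (c i : ℂ) • Φ i x with hQ
  -- (1) `H_Y − Σcᵢ Hᵢ = Q X`
  have hHY : HY = Φ₀ X + adh Y X := solution_eq_phi_add_adh hU₀ hU₀' θ₀ hβ₀ hYU X HY hY
  have hHi : ∀ i, H i = Φ i X + adh (Z i) X := fun i => solution_eq_phi_add_adh (hV i) (hV' i) (θ i) (hβπ i) (hZV i) X (H i) (hH i)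
  have hadh : adh Y X = ∑ i, (c i : ℂ) • adh (Z i) X := adh_sum_smul c Z X
  have hG : HY - ∑ i, (c i : ℂ) • H i = Q X := by
    rw [hQ, hHY, hadh]
    simp only [hHi, smul_add, Finset.sum_add_distrib]
    abel
  rw [hG]
  -- (2) the hypotheses of the abstract Cauchy–Schwarz lemma
  have hadd : ∀ x y, Q (x + y) = Q x + Q y := by
    intro x y
    simp only [hQ, hΦ₀, hΦ, frameMul_add, smul_add, Finset.sum_add_distrib]
    abel
  have hsmul : ∀ (t : ℝ) (x : Matrix m m ℂ), Q ((t : ℂ) • x) = (t : ℂ) • Q x := by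
    intro t x
    simp only [hQ, hΦ₀, hΦ, frameMul_smul, smul_sub, Finset.smul_sum, smul_comm (c _ : ℂ) (t : ℂ)]
  have hsymm : ∀ x y, hs x (Q y) = hs (Q x) y := by
    intro x y
    simp only [hQ, hΦ₀, hΦ, hs_sub_right, hs_sub_left, hs_sum_right, hs_sum_left, hs_smul_right, hs_smul_left]
    rw [hs_frameMul_symm hU₀ hU₀']
    congr 1
    exact Finset.sum_congr rfl fun i _ => by rw [hs_frameMul_symm (hV i) (hV' i)]
  have hpos : ∀ x, 0 ≤ hs x (Q x) := by
    intro x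
    -- `Q x = (φ₀ x + adh Y x) − Σ cᵢ (φᵢ x + adh Zᵢ x)` and these are solutions for the right side `x`
    have hsolY := dexp_phi_add_adh hU₀ hU₀' θ₀ hβ₀ hYU x
    have hsoli := fun i => dexp_phi_add_adh (hV i) (hV' i) (θ i) (hβπ i) (hZV i) x
    have hj := jensen_hs_le hZ hZ1 c hc0 hc1 x (fun i => Φ i x + adh (Z i) x) (Φ₀ x + adh Y x) hsoli hsolY
    have e1 : hs x (Φ₀ x + adh Y x) = hs x (Φ₀ x) := by rw [hs_add_right, hs_adh_self hYskew, add_zero]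
    have e2 : ∀ i, hs x (Φ i x + adh (Z i) x) = hs x (Φ i x) := fun i => by
      rw [hs_add_right, hs_adh_self (hZ i), add_zero]
    simp only [e1, e2] at hj
    have e : hs x (Q x) = hs x (Φ₀ x) - ∑ i, c i * hs x (Φ i x) := by
      simp only [hQ, hs_sub_right, hs_sum_right, hs_smul_right]
    rw [e]
    have hlam : 0 ≤ (1 - ∑ i, c i) * hs x x := mul_nonneg (by linarith) (hs_self_nonneg x)
    linarith
  set κ : ℝ := 1 - ∑ i, c i * (1 - ψ (ρ i)) with hκ
  have hκ0 : 0 ≤ κ := by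
    have h1 : ∑ i, c i * (1 - ψ (ρ i)) ≤ ∑ i, c i := Finset.sum_le_sum fun i _ => by
      have hρπ : |ρ i| < Real.pi := by
        rw [abs_of_nonneg ((norm_nonneg _).trans (hZρ i))]; linarith [hρ1 i, Real.pi_gt_three]
      nlinarith [hc0 i, ψ_nonneg_of_abs_lt_pi hρπ]
    linarith
  have hup : ∀ x, hs x (Q x) ≤ κ * hs x x := by
    intro x
    have h0 : hs x (Φ₀ x) ≤ hs x x :=
      hs_frameMul_self_le hU₀ hU₀' (fun a b => one_sub_ψ_le_one (hβ₀ a b)) x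
    have hi : ∀ i, (1 - ψ (ρ i)) * hs x x ≤ hs x (Φ i x) := fun i =>
      hs_frameMul_self_ge (hV i) (hV' i) (fun a b => by
        have hρπ : ρ i < Real.pi := by linarith [hρ1 i, Real.pi_gt_three]
        linarith [ψ_le_ψ_of_abs_le (hβρ i a b) hρπ]) x
    have e : hs x (Q x) = hs x (Φ₀ x) - ∑ i, c i * hs x (Φ i x) := by
      simp only [hQ, hs_sub_right, hs_sum_right, hs_smul_right]
    rw [e, hκ, sub_mul, one_mul, Finset.sum_mul]
    have h2 : ∑ i, c i * (1 - ψ (ρ i)) * hs x x ≤ ∑ i, c i * hs x (Φ i x) := Finset.sum_le_sum fun i _ => by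
      rw [mul_assoc]; exact mul_le_mul_of_nonneg_left (hi i) (hc0 i)
    linarith
  exact hs_apply_self_le_of_symm_psd hadd hsmul hsymm hpos hκ0 hup X

end Operator

/-! ## §3 THE TANGENT MAP OF `K_W = exp(Σᵢ cᵢ log(hᵢW*))·W` IS AN hs-CONTRACTION ON THE GUARD -/

section EML

omit [Fintype ι] in
/-- **`|dexp Y| ≤ 1` in Hilbert–Schmidt norm** for skew-Hermitian `Y`, `‖Y‖ ≤ 1`: `hs(dexp Y G, dexp Y G) ≤ hs(G, G)` — in `Y`'s eigenframe
`dexp Y` multiplies the `(a,b)` coordinate by `dd(−iθₐ,−iθ_b)`, of modulus `sinc β_{ab} ≤ 1` (g3's `norm_dd_eq`). [folklore] -/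
theorem hs_dexp_self_le {Y : Matrix m m ℂ} (hY : Yᴴ = -Y) (hY1 : ‖Y‖ ≤ 1) (G : Matrix m m ℂ) :
    hs (dexp Y G) (dexp Y G) ≤ hs G G := by
  obtain ⟨U, θ, hU, hU', hYU, hβ⟩ := exists_frame_lt_pi hY hY1
  have hl : ∀ a b, Y * Fu U a b = (-I * (θ a : ℂ)) • Fu U a b := fun a b => by
    rw [hYU]; exact frame_mul_Fu hU _ a b
  have hr : ∀ a b, Fu U a b * Y = (-I * (θ b : ℂ)) • Fu U a b := fun a b => by
    rw [hYU]; exact Fu_mul_frame hU _ a b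
  have hdexp : ∀ a b, dexp Y (Fu U a b) = dd (-I * θ a) (-I * θ b) • Fu U a b := fun a b =>
    dexp_eigen (hl a b) (hr a b)
  have h1 : dexp Y G = U * Matrix.of (fun a b => dd (-I * θ a) (-I * θ b) * (star U * G * U) a b) * star U := by
    conv_lhs => rw [(conj_unconj hU' G).symm]
    have h := linmap_frame (dexp Y).toLinearMap _ hdexp (star U * G * U)
    rwa [ContinuousLinearMap.coe_coe] at h
  rw [h1]
  exact hs_frameMul_frameMul_le hU hU' (fun a b => by rw [norm_dd_eq (hβ a b)]; exact Real.sinc_le_one _) G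

/-- ★★★ **THE UPPER HALF OF THE JACOBIAN PINCH.**  For unitary `W`, unitaries `hᵢ` in the guard `‖hᵢW* − 1‖ < 1∕2`, weights `cᵢ ≥ 0`
with `Σcᵢ ≤ 1`, a skew-Hermitian `X`, and radii `‖log(hᵢW*)‖ ≤ ρᵢ ≤ 1`:
  `hs(D K_W(W X), D K_W(W X)) ≤ (1 − Σᵢ cᵢ·(1 − ψ ρᵢ))²·hs(X, X)`,   `1 − ψρ = ρ cot ρ`,
i.e. `‖D K_W(WX)‖_HS ≤ (1 − Σcᵢ ρᵢcot ρᵢ)·‖X‖_HS`.  PROOF: `D K_W(WX)·W* = dexp(Y)·(H_Y − ΣcᵢHᵢ)` for the solutions `Hᵢ = D log(hᵢW*)(hᵢW*X̃)`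
of the `Zᵢ`-systems and a `Y`-solution `H_Y` (g3's bookkeeping, `dexp` onto); `|dexp Y| ≤ 1` (`hs_dexp_self_le`) and §2's
`hs_symmetrised_self_le`.  Companion of the lower half `(1 − Σcᵢ)²·hs(X,X) ≤ hs(DK_W(WX), DK_W(WX))` (g3's p612264); both constants are
`1 − Σcᵢ` at the flat background (`GuardJacobian.emlD_flat`). [folklore] -/
theorem emlD_tangent_upper_bound {h : ι → Matrix m m ℂ} (hh : ∀ i, h i ∈ unitaryGroup m ℂ) {W : Matrix m m ℂ}
    (hWu : W ∈ unitaryGroup m ℂ) (hg : ∀ i, ‖h i * star W - 1‖ < 1 / 2) {c : ι → ℝ} (hc0 : ∀ i, 0 ≤ c i)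
    (hc1 : ∑ i, c i ≤ 1) (ρ : ι → ℝ) (hρ : ∀ i, ‖mlog (h i * star W)‖ ≤ ρ i) (hρ1 : ∀ i, ρ i ≤ 1)
    (X : Matrix m m ℂ) (hX : Xᴴ = -X) :
    hs (emlD h c W (W * X)) (emlD h c W (W * X)) ≤ (1 - ∑ i, c i * (1 - ψ (ρ i))) ^ 2 * hs X X := by
  have hW1 : star W * W = 1 := Matrix.mem_unitaryGroup_iff'.mp hWu
  have hW2 : W * star W = 1 := Matrix.mem_unitaryGroup_iff.mp hWu
  have hP1 : ∀ i, ‖h i * star W - 1‖ < 1 := fun i => lt_trans (hg i) (by norm_num)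
  obtain ⟨hZskew, -, hYskew, hYn⟩ := guard_skew_norm hh hWu hg hc0 hc1
  have hX' : star X = -X := by rw [Matrix.star_eq_conjTranspose, hX]
  set Y : Matrix m m ℂ := ∑ i, (c i : ℂ) • mlog (h i * star W)
  set Xt : Matrix m m ℂ := W * X * star W with hXt
  set E : Matrix m m ℂ := emlD h c W (W * X)
  set H : ι → Matrix m m ℂ := fun i => fderiv ℂ mlog (h i * star W) (h i * star W * Xt)
  have hHi : ∀ i, dexp (mlog (h i * star W)) (H i) = exp (mlog (h i * star W)) * Xt := fun i => by
    show dexp (mlog (h i * star W)) (fderiv ℂ mlog (h i * star W) (h i * star W * Xt)) = _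
    rw [dexp_mlog_fderiv (hP1 i), MatrixLog.exp_mlog (hP1 i)]
  have hPX : ∀ i, h i * star (W * X) = -(h i * star W * Xt) := by
    intro i
    rw [star_mul, hX', neg_mul, mul_neg, hXt, show h i * star W * (W * X * star W)
      = h i * (star W * W) * (X * star W) by noncomm_ring, hW1, mul_one]
  have hE : E * star W = exp Y * Xt - dexp Y (∑ i, (c i : ℂ) • H i) := by
    have h0 : E = exp Y * (W * X) + dexp Y (∑ i, (c i : ℂ) • fderiv ℂ mlog (h i * star W) (h i * star (W * X))) * W :=
      emlD_apply h c W (W * X)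
    have h1 : (∑ i, (c i : ℂ) • fderiv ℂ mlog (h i * star W) (h i * star (W * X))) = -∑ i, (c i : ℂ) • H i := by
      rw [← Finset.sum_neg_distrib]
      refine Finset.sum_congr rfl fun i _ => ?_
      rw [hPX, map_neg, smul_neg]
    have h0' : E = exp Y * (W * X) - dexp Y (∑ i, (c i : ℂ) • H i) * W := by
      rw [h0, h1, map_neg, neg_mul, ← sub_eq_add_neg]
    rw [h0', hXt, sub_mul, mul_assoc, mul_assoc (dexp Y _) W (star W), hW2, mul_one]
  obtain ⟨G', hG'⟩ := (dexp_lower_bound_and_surjective hYskew one_pos (by linarith [Real.pi_gt_three]) hYn).2 (E * star W)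
  have hY : dexp Y (G' + ∑ i, (c i : ℂ) • H i) = exp Y * Xt := by
    rw [map_add, hG', hE]; abel
  have key := hs_symmetrised_self_le hZskew ρ hρ hρ1 c hc0 hc1 Xt H _ hHi hY
  rw [add_sub_cancel_right] at key
  have hXX : hs Xt Xt = hs X X := by rw [hXt]; exact hs_conj hW1 X X
  calc hs E E = hs (E * star W) (E * star W) := (hs_mul_star_unitary hW1 E E).symm
    _ = hs (dexp Y G') (dexp Y G') := by rw [hG']
    _ ≤ hs G' G' := hs_dexp_self_le hYskew hYn G'
    _ ≤ (1 - ∑ i, c i * (1 - ψ (ρ i))) ^ 2 * hs Xt Xt := key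
    _ = (1 - ∑ i, c i * (1 - ψ (ρ i))) ^ 2 * hs X X := by rw [hXX]

/-- ★★ **THE W-UNIFORM CONSTANT**: on the guard `‖log(hᵢW*)‖ < log 2`, so `‖D K_W(WX)‖_HS ≤ (1 − (log 2·cot log 2)·Σcᵢ)·‖X‖_HS`
(`log 2 · cot log 2 = 0.835…`). [folklore] -/
theorem emlD_tangent_upper_bound_log_two {h : ι → Matrix m m ℂ} (hh : ∀ i, h i ∈ unitaryGroup m ℂ) {W : Matrix m m ℂ}
    (hWu : W ∈ unitaryGroup m ℂ) (hg : ∀ i, ‖h i * star W - 1‖ < 1 / 2) {c : ι → ℝ} (hc0 : ∀ i, 0 ≤ c i)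
    (hc1 : ∑ i, c i ≤ 1) (X : Matrix m m ℂ) (hX : Xᴴ = -X) :
    hs (emlD h c W (W * X)) (emlD h c W (W * X)) ≤ (1 - (1 - ψ (Real.log 2)) * ∑ i, c i) ^ 2 * hs X X := by
  have hl2 : Real.log 2 ≤ 1 := by have := Real.log_two_lt_d9; linarith
  have h := emlD_tangent_upper_bound hh hWu hg hc0 hc1 (fun _ => Real.log 2) (fun i => (norm_mlog_lt_log_two (hg i)).le)
    (fun _ => hl2) X hX
  rw [← Finset.sum_mul] at h
  rwa [mul_comm (1 - ψ (Real.log 2))]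

/-- ★★ **THE TANGENT MAP IS AN hs-CONTRACTION ON THE GUARD**: `hs(D K_W(W X), D K_W(W X)) ≤ hs(X, X)` — `K` infinitesimally shrinks
Hilbert–Schmidt lengths along the fibre, every `N`, uniformly in `W` and the `hᵢ`. [folklore] -/
theorem emlD_tangent_contraction {h : ι → Matrix m m ℂ} (hh : ∀ i, h i ∈ unitaryGroup m ℂ) {W : Matrix m m ℂ}
    (hWu : W ∈ unitaryGroup m ℂ) (hg : ∀ i, ‖h i * star W - 1‖ < 1 / 2) {c : ι → ℝ} (hc0 : ∀ i, 0 ≤ c i)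
    (hc1 : ∑ i, c i ≤ 1) (X : Matrix m m ℂ) (hX : Xᴴ = -X) :
    hs (emlD h c W (W * X)) (emlD h c W (W * X)) ≤ hs X X := by
  have h := emlD_tangent_upper_bound_log_two hh hWu hg hc0 hc1 X hX
  have hψ1 : ψ (Real.log 2) ≤ 1 := ψ_le_one_of_abs_le_one (by
    rw [abs_of_pos (Real.log_pos one_lt_two)]; have := Real.log_two_lt_d9; linarith)
  have hψ0 : 0 ≤ ψ (Real.log 2) := ψ_nonneg_of_abs_lt_pi (by
    rw [abs_of_pos (Real.log_pos one_lt_two)]; have := Real.log_two_lt_d9; linarith [Real.pi_gt_three])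
  have hs0 : 0 ≤ ∑ i, c i := Finset.sum_nonneg fun i _ => hc0 i
  set κ : ℝ := 1 - (1 - ψ (Real.log 2)) * ∑ i, c i
  have hκ0 : 0 ≤ κ := by nlinarith
  have hκ1 : κ ≤ 1 := by nlinarith
  have hκ2 : κ ^ 2 ≤ 1 := by nlinarith
  nlinarith [hs_self_nonneg X]

/-- ★★ **AT THE TYPED GUARD OF THE PRINTED AVERAGE ON `SU(N)`** (`ExpMeanLog.deltaSU = min(1∕3, π∕N)`): for `hᵢ, W ∈ SU(N)` the tangent map of
the fibre map is an hs-contraction, every `N`. [folklore] -/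
theorem emlD_tangent_contraction_specialUnitary {n : Type} [DecidableEq n] [Fintype n] [Nonempty n]
    (h : ι → Matrix.specialUnitaryGroup n ℂ) (W : Matrix.specialUnitaryGroup n ℂ)
    (hg : ∀ i, ‖(h i : Matrix n n ℂ) * star (W : Matrix n n ℂ) - 1‖ < ExpMeanLog.deltaSU n)
    {c : ι → ℝ} (hc0 : ∀ i, 0 ≤ c i) (hc1 : ∑ i, c i ≤ 1) (X : Matrix n n ℂ) (hX : Xᴴ = -X) :
    hs (emlD (fun i => (h i : Matrix n n ℂ)) c W (W * X)) (emlD (fun i => (h i : Matrix n n ℂ)) c W (W * X)) ≤ hs X X := by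
  have hh : ∀ i, (h i : Matrix n n ℂ) ∈ unitaryGroup n ℂ := fun i => (Matrix.mem_specialUnitaryGroup_iff.mp (h i).2).1
  have hWu : (W : Matrix n n ℂ) ∈ unitaryGroup n ℂ := (Matrix.mem_specialUnitaryGroup_iff.mp W.2).1
  have hg' : ∀ i, ‖(h i : Matrix n n ℂ) * star (W : Matrix n n ℂ) - 1‖ < 1 / 2 := fun i => by
    have := ExpMeanLog.lt_third_of_lt_deltaSU (hg i); linarith
  exact emlD_tangent_contraction hh hWu hg' hc0 hc1 X hX

end EML

end Summit.QuantumFields.YangMills.BalabanUVNodes.N08HaarCompatibilityGuardJacobianContractionOperator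

end
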